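import Mathlib
import Literature.Geometry.Riemannian.GurskyViaclovskyPath
import HarnessLib

/-!
# GurskyViaclovskyOpenness

Topic `Literature/Geometry/Riemannian`. Named literature fact(s) relocated by the gate from `Summits/SmoothPoincare4/SmoothPoincare4/Theorems/EntropyRungChangGurskyYangStubPathOpen.lean`
(accept-time relocation of `[cite]`d propositions written inline in a Summits proposal; human ruling 2026-08-15).
Sources: ChangGurskyYang2003, GilbargTrudinger2001, GurskyViaclovsky2003.

* `Literature.Geometry.Riemannian.gurskyViaclovsky_pathOpen_weighted_four`
-/

namespace Literature.Geometry.Riemannian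

open scoped Manifold ContDiff Topology
open Set Filter
open Literature.Geometry.Lorentzian (PseudoRiemannianMetric)
open Literature.Geometry.Lorentzian.PseudoRiemannianMetric
open Literature.Geometry.Riemannian
open Literature.Geometry.Riemannian.GurskyViaclovskyPath

/-- NAMED FACT (**Gursky–Viaclovsky 2003, Prop. 2 and §5: the solvable set `𝒮` of the `σ₂`
continuity path is open below `t = 1`, along the Weyl-weighted path**). The source
(J. Differential Geom. 63 (2003), arXiv:math/0301350), §2, Prop. 2: "Let `u ∈ C²(M)` be a solution
of `σ₂^{1/2}(g⁻¹A^t_u) = f(x) e^{2u}`, for some `t ≤ 1` with `A^t_u ∈ Γ₂⁺`. Then the linearized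
operator at `u`, `𝓛^t : C^{2,α}(M) → C^α(M)`, is invertible `(0 < α < 1)`" (proof: solutions are
zeroes of `F_t = σ₂(g⁻¹A^t_u) − f(x)² e^{4u}`;
`𝓛^t(φ) = L^t(g⁻¹A^t_u)_{ij}(g⁻¹∇²φ)_{ij} − 4f² e^{4u} φ + ⋯`; "For `t ≤ 1`, Proposition (ellsumm)
implies that `L^t(g⁻¹A^t_u)` is positive definite, so `𝓛^t` is elliptic. Since the coefficient of
`φ` in the zeroth-order term is strictly negative, the linearization is furthermore invertible on
the stated Hölder spaces (see [GT])"); and §5, proof of Thm. 1, for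
`𝒮 = {t ∈ [δ, t₀] | ∃ a solution u_t ∈ C^{2,α}(M) of (path) with A^t_{u_t} ∈ Γ₂⁺}`: "Let `t ∈ 𝒮`,
and `u_t` be any solution. From Proposition (linvert), the linearized operator at `u_t`,
`𝓛^t : C^{2,α}(M) → C^α(M)`, is invertible. The implicit function theorem (see [GT]) implies that
`𝒮` is open. Note that since `f ∈ C^∞(M)`, it follows from classical elliptic regularity theory
that `u_t ∈ C^∞(M)`", where [GT] is Gilbarg–Trudinger, Thm. 17.6 (implicit function theorem in
Banach spaces). Here `M` is a closed `4`-manifold, `A^t_g = ½(Ric − (t/6)R g)`,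
`A^t_u = A^t_g + ∇²u + ((1−t)/2)(Δu)g + du⊗du − ((2−t)/2)|∇u|²g` (§2), `Γ₂⁺ = {σ₂ > 0} ∩ {σ₁ > 0}`
(Def. 1).
**Vended form** — the special case the line `gv-continuity-path` consumes: `C^∞` data on
`ℝ⁴`-charts, a compact connected `M`, and the WEYL-WEIGHTED path of Chang–Gursky–Yang 2003, (1.10)
(`α = 1`) read on the conformal metric, in the vocabulary of
`Literature/Geometry/Riemannian/GurskyViaclovskyPath.lean`
(`Literature.Geometry.Riemannian.GurskyViaclovskyPath.Solvable g t q`: some `C^∞` metric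
`h = e^{−2u} g` with its Levi-Civita connection, `u ∈ C^∞`, `h` Riemannian, `R_h > 0`, and
`σ₂(A_h) − ¼|W_h|² + (1−t)(2−t)R_h²/6 = q e^{8u}`; on the background `g` this is
`σ₂(g⁻¹A^t_u) = (1/16)|W_g|²_g + (q/4)e^{4u}` with `A^t_u ∈ Γ₂⁺` for `t ≤ 1`, module docstring
"Dictionary" there): for a `C^∞` Riemannian `g`, a `C^∞` right side `q > 0` and `t₀ ≤ 1` with
`t₀ ∈ 𝒮`, all `t ≤ 1` in a neighbourhood `(t₀ − ε, t₀ + ε)` lie in `𝒮`, solutions being recorded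
`C^∞` (as they are by elliptic regularity, §5). HONESTY NOTE: Gursky–Viaclovsky print the
unweighted right side `f(x)² e^{4u}`; with the weight the zero-finding map is
`F_t − (1/16)|W_g|²_g` (`f² = q/4`), the added term is independent of `u`, so the linearisation is
the printed `𝓛^t` with zeroth-order coefficient `−q e^{4u} < 0` and the same principal part
`L^t(g⁻¹A^t_u)` (elliptic for `A^t_u ∈ Γ₂⁺`, `t ≤ 1`, Prop. 1(ii)); Prop. 2, the implicit function
theorem in `C^{2,α} × ℝ → C^α` and elliptic regularity (the right side is `C^∞` in `(x, u)`) go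
through word for word — Gursky–Viaclovsky, §1: "The choice of the right hand side in (PDE) is quite
flexible; the key requirement is simply that the exponent is a positive multiple of `u`" — and
admissibility persists near `t₀` (`σ₂ > 0` is forced by `q > 0`, so `σ₁ ≠ 0` pointwise and
`σ₁ > 0` propagates by continuity of `t ↦ u_t`). Hölder spaces on closed manifolds, Schauder theory
and fully nonlinear elliptic regularity are absent from Mathlib and the tree: no `_holds`. (The
body is written without scoped notation — `modelWithCornersSelf ℝ (EuclideanSpace ℝ (Fin 4))` for
`𝓡 4`, `modelWithCornersSelf ℝ ℝ` for `𝓘(ℝ)`, `((⊤ : ℕ∞) : WithTop ℕ∞)` for the smoothness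
exponent `∞` — and with fully qualified tree names, so that it elaborates under any `open`
preamble; it is syntactically the registered stub `stub_pathOpen` of the line.) Users take
`(hO : gurskyViaclovsky_pathOpen_weighted_four)`.
-- TODO(general form): Gursky–Viaclovsky's argument gives openness of `𝒮` in `C^{2,α}(M)` for
-- `σ₂^{1/2}(g⁻¹A^t_u) = F(x, u)` with any `C^∞` right side `F > 0`, `∂_u F > 0`, at every
-- admissible `C²` solution with `t ≤ 1`, on any closed `4`-manifold and for metrics of finite
-- regularity, together with the invertibility statement of Prop. 2 itself and the `C¹`
-- dependence `t ↦ u_t` from the implicit function theorem; only the `C^∞`, Weyl-weighted,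
-- existence-of-a-neighbourhood consequence below `t = 1` is stated.
[cite: GurskyViaclovsky2003, Prop. 2 (§2) and §5 (proof of Thm. 1)]
[cite: GilbargTrudinger2001, Thm. 17.6] [cite: ChangGurskyYang2003, (1.10)]
[file Geometry/Riemannian/GurskyViaclovskyOpenness] -/
def gurskyViaclovsky_pathOpen_weighted_four : Prop :=
  ∀ (M : Type) [TopologicalSpace M] [T2Space M] [SecondCountableTopology M]
    [ChartedSpace (EuclideanSpace ℝ (Fin 4)) M]
    [IsManifold (modelWithCornersSelf ℝ (EuclideanSpace ℝ (Fin 4))) ((⊤ : ℕ∞) : WithTop ℕ∞) M]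
    [CompactSpace M] [ConnectedSpace M]
    (g : Literature.Geometry.Lorentzian.PseudoRiemannianMetric
      (modelWithCornersSelf ℝ (EuclideanSpace ℝ (Fin 4))) ((⊤ : ℕ∞) : WithTop ℕ∞)
      (EuclideanSpace ℝ (Fin 4))
      (TangentSpace (modelWithCornersSelf ℝ (EuclideanSpace ℝ (Fin 4))) : M → Type _))
    [g.HasLeviCivita], g.IsRiemannian →
    ∀ (q : M → ℝ),
      ContMDiff (modelWithCornersSelf ℝ (EuclideanSpace ℝ (Fin 4))) (modelWithCornersSelf ℝ ℝ)
        ((⊤ : ℕ∞) : WithTop ℕ∞) q →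
      (∀ x, 0 < q x) →
      ∀ t₀ : ℝ, t₀ ≤ 1 →
        Literature.Geometry.Riemannian.GurskyViaclovskyPath.Solvable g t₀ q →
        ∃ ε : ℝ, 0 < ε ∧ ∀ t : ℝ, t₀ - ε < t → t < t₀ + ε → t ≤ 1 →
          Literature.Geometry.Riemannian.GurskyViaclovskyPath.Solvable g t q

end Literature.Geometry.Riemannian
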